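import Summits.CriticalPhenomena.PercolationContinuityZ3.Theorems.PercNearOneGluingNoHeavyLowerTailSahiE3TwoPrimeSlotQuad
import Mathlib.Tactic.Linarith
import Mathlib.Tactic.Ring
import Mathlib.Tactic.Positivity
import Mathlib.Tactic.FieldSimp
import HarnessLib
import HarnessLib.Audit

/-!
# `NoHeavyLowerTail` (crux stmt-CriticalPhenomena-4575), Sahi programme P4 (Holley / monotone coupling):
# FKG slot-locality at two join-primes — the real inequality behind it, II: shifts, density form, mass form

Support file (cell `prim-l12`, seat P4, generation 6; `--supports stmt-CriticalPhenomena-4575`).  No named facts, no sorries;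
standard axioms.  Continues `…SahiE3TwoPrimeSlotQuad` (the bilinear form `quadQ` and its copositivity on the cone of increasing
increments); the statement proved here, `phiM_nonneg`, is what the lattice theorem `…SahiE3TwoPrimeSlot` instantiates with fibre
masses.  See the docstring of `…SahiE3TwoPrimeSlotQuad` for the whole argument; this file contains steps (1), (2), (4): the
existence of the shifts `E₁, E₂` (`exists_shift`), the decomposition of Sahi's functional in fibre densities (`phiD_nonneg`), and the
passage to fibre masses with fibres of mass zero allowed (`phiM_nonneg`, phantom densities).
-/

namespace Summit.CriticalPhenomena.PercolationContinuityZ3.Theorems.SahiE3TwoPrimeSlot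

/-! ### The shifts -/

/-- **Existence of the shifts.**  For nonnegative pattern masses with `ν₁ν₂ ≤ ν₀ν₃` there are `E₁, E₂ ≥ 0` with `E₁ + E₂ ≤ ν₃`,
`ν₀E_t ≤ Zν_t` and `(Z+ν₀)ν₁ν₂ ≤ ν₀²ν₃ + Zν₀(E₁+E₂)`: take `E_t = ν₃ν_t/(ν₁+ν₂)` if `ν₀ν₃ ≤ Z(ν₁+ν₂)` and `E_t = Zν_t/ν₀`
otherwise. [this work] -/
theorem exists_shift {ν₀ ν₁ ν₂ ν₃ : ℝ} (h0 : 0 ≤ ν₀) (h1 : 0 ≤ ν₁) (h2 : 0 ≤ ν₂) (h3 : 0 ≤ ν₃) (hfkg : ν₁ * ν₂ ≤ ν₀ * ν₃) :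
    ∃ E₁ E₂ : ℝ, 0 ≤ E₁ ∧ 0 ≤ E₂ ∧ E₁ + E₂ ≤ ν₃ ∧ ν₀ * E₁ ≤ (ν₀ + ν₁ + ν₂ + ν₃) * ν₁ ∧ ν₀ * E₂ ≤ (ν₀ + ν₁ + ν₂ + ν₃) * ν₂ ∧
      (ν₀ + ν₁ + ν₂ + ν₃ + ν₀) * ν₁ * ν₂ ≤ ν₀ ^ 2 * ν₃ + (ν₀ + ν₁ + ν₂ + ν₃) * ν₀ * (E₁ + E₂) := by
  by_cases hA : ν₀ * ν₃ ≤ (ν₀ + ν₁ + ν₂ + ν₃) * (ν₁ + ν₂)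
  · by_cases hs : ν₁ + ν₂ = 0
    · have e1 : ν₁ = 0 := by linarith
      have e2 : ν₂ = 0 := by linarith
      refine ⟨0, 0, le_rfl, le_rfl, by linarith, by nlinarith, by nlinarith, ?_⟩
      rw [e1, e2]; nlinarith
    · have hs' : 0 < ν₁ + ν₂ := lt_of_le_of_ne (add_nonneg h1 h2) (Ne.symm hs)
      refine ⟨ν₃ * ν₁ / (ν₁ + ν₂), ν₃ * ν₂ / (ν₁ + ν₂), by positivity, by positivity, ?_, ?_, ?_, ?_⟩
      · rw [← add_div, div_le_iff₀ hs']; nlinarith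
      · rw [← mul_div_assoc, div_le_iff₀ hs']; nlinarith [mul_le_mul_of_nonneg_left hA h1]
      · rw [← mul_div_assoc, div_le_iff₀ hs']; nlinarith [mul_le_mul_of_nonneg_left hA h2]
      · have hsum : ν₃ * ν₁ / (ν₁ + ν₂) + ν₃ * ν₂ / (ν₁ + ν₂) = ν₃ := by
          rw [← add_div, div_eq_iff (ne_of_gt hs')]; ring
        rw [hsum]; nlinarith [mul_le_mul_of_nonneg_left hfkg h0, mul_le_mul_of_nonneg_left hfkg (add_nonneg (add_nonneg (add_nonneg h0 h1) h2) h3)]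
  · have hA' : (ν₀ + ν₁ + ν₂ + ν₃) * (ν₁ + ν₂) < ν₀ * ν₃ := lt_of_not_ge hA
    have hZ : 0 ≤ ν₀ + ν₁ + ν₂ + ν₃ := by linarith
    have h0' : 0 < ν₀ := by
      rcases h0.eq_or_lt with h | h
      · exfalso; rw [← h] at hA'; nlinarith [mul_nonneg hZ (add_nonneg h1 h2)]
      · exact h
    refine ⟨(ν₀ + ν₁ + ν₂ + ν₃) * ν₁ / ν₀, (ν₀ + ν₁ + ν₂ + ν₃) * ν₂ / ν₀, by positivity, by positivity, ?_, ?_, ?_, ?_⟩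
    · rw [← add_div, div_le_iff₀ h0']; nlinarith
    · have hne := ne_of_gt h0'
      exact le_of_eq (by field_simp)
    · have hne := ne_of_gt h0'
      exact le_of_eq (by field_simp)
    · have hsum : (ν₀ + ν₁ + ν₂ + ν₃) * ν₀ * ((ν₀ + ν₁ + ν₂ + ν₃) * ν₁ / ν₀ + (ν₀ + ν₁ + ν₂ + ν₃) * ν₂ / ν₀)
          = (ν₀ + ν₁ + ν₂ + ν₃) ^ 2 * (ν₁ + ν₂) := by
        have hne := ne_of_gt h0'
        field_simp
      rw [hsum]
      nlinarith [mul_nonneg (mul_nonneg hZ h1) (show 0 ≤ ν₀ + ν₁ + ν₃ by linarith),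
        mul_nonneg (mul_nonneg hZ h2) (show 0 ≤ ν₀ + ν₂ + ν₃ by linarith), mul_nonneg (mul_nonneg h1 h2) (show 0 ≤ ν₁ + ν₂ + ν₃ by linarith),
        mul_nonneg (sq_nonneg ν₀) h3]

/-! ### The density form -/

/-- **The real inequality behind FKG slot-locality at two join-primes (density form).**  For nonnegative pattern masses with
`ν₁ν₂ ≤ ν₀ν₃`, densities `α, β` nonnegative at `0` and increasing along `0 ≤ 1, 2 ≤ 3`, and `γ_t ≥ max(γ₀, α_tβ_t)` for
`t = 1, 2, 3`: `phiD ≥ 0`.  See the file docstring for the proof. [this work] -/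
theorem phiD_nonneg {ν₀ ν₁ ν₂ ν₃ α₀ α₁ α₂ α₃ β₀ β₁ β₂ β₃ γ₀ γ₁ γ₂ γ₃ : ℝ}
    (h0 : 0 ≤ ν₀) (h1 : 0 ≤ ν₁) (h2 : 0 ≤ ν₂) (h3 : 0 ≤ ν₃) (hfkg : ν₁ * ν₂ ≤ ν₀ * ν₃)
    (hα0 : 0 ≤ α₀) (hα01 : α₀ ≤ α₁) (hα02 : α₀ ≤ α₂) (hα13 : α₁ ≤ α₃) (hα23 : α₂ ≤ α₃)
    (hβ0 : 0 ≤ β₀) (hβ01 : β₀ ≤ β₁) (hβ02 : β₀ ≤ β₂) (hβ13 : β₁ ≤ β₃) (hβ23 : β₂ ≤ β₃)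
    (hγ1 : γ₀ ≤ γ₁) (hγ2 : γ₀ ≤ γ₂) (hγ3 : γ₀ ≤ γ₃) (hf1 : α₁ * β₁ ≤ γ₁) (hf2 : α₂ * β₂ ≤ γ₂) (hf3 : α₃ * β₃ ≤ γ₃) :
    0 ≤ (2 * (ν₀ + ν₁ + ν₂ + ν₃) ^ 2 * (ν₁ * γ₁ + ν₂ * γ₂ + ν₃ * γ₃)
    + (ν₁ + ν₂ + ν₃) * (ν₀ * α₀ + ν₁ * α₁ + ν₂ * α₂ + ν₃ * α₃) * (ν₀ * β₀ + ν₁ * β₁ + ν₂ * β₂ + ν₃ * β₃)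
    - (ν₀ + ν₁ + ν₂ + ν₃) * ((ν₁ + ν₂ + ν₃) * (ν₀ * γ₀ + ν₁ * γ₁ + ν₂ * γ₂ + ν₃ * γ₃)
        + (ν₀ * α₀ + ν₁ * α₁ + ν₂ * α₂ + ν₃ * α₃) * (ν₁ * β₁ + ν₂ * β₂ + ν₃ * β₃)
        + (ν₀ * β₀ + ν₁ * β₁ + ν₂ * β₂ + ν₃ * β₃) * (ν₁ * α₁ + ν₂ * α₂ + ν₃ * α₃))) := by
  obtain ⟨E₁, E₂, hE1, hE2, hE3, hc1, hc2, hkey⟩ := exists_shift h0 h1 h2 h3 hfkg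
  have hq := quadQ_nonneg (x₁ := α₁ - α₀) (x₂ := α₂ - α₀) (x₃ := α₃ - α₀) (y₁ := β₁ - β₀) (y₂ := β₂ - β₀) (y₃ := β₃ - β₀)
    h0 h1 h2 h3 hE1 hE2 hkey (sub_nonneg.2 hα01) (sub_nonneg.2 hα02) (by linarith)
    (by linarith) (sub_nonneg.2 hβ01) (sub_nonneg.2 hβ02) (by linarith) (by linarith)
  have hZ : 0 ≤ ν₀ + ν₁ + ν₂ + ν₃ := by linarith
  have e : (2 * (ν₀ + ν₁ + ν₂ + ν₃) ^ 2 * (ν₁ * γ₁ + ν₂ * γ₂ + ν₃ * γ₃)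
    + (ν₁ + ν₂ + ν₃) * (ν₀ * α₀ + ν₁ * α₁ + ν₂ * α₂ + ν₃ * α₃) * (ν₀ * β₀ + ν₁ * β₁ + ν₂ * β₂ + ν₃ * β₃)
    - (ν₀ + ν₁ + ν₂ + ν₃) * ((ν₁ + ν₂ + ν₃) * (ν₀ * γ₀ + ν₁ * γ₁ + ν₂ * γ₂ + ν₃ * γ₃)
        + (ν₀ * α₀ + ν₁ * α₁ + ν₂ * α₂ + ν₃ * α₃) * (ν₁ * β₁ + ν₂ * β₂ + ν₃ * β₃)
        + (ν₀ * β₀ + ν₁ * β₁ + ν₂ * β₂ + ν₃ * β₃) * (ν₁ * α₁ + ν₂ * α₂ + ν₃ * α₃))) =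
      (ν₀ + ν₁ + ν₂ + ν₃) * ((ν₀ + ν₁ + ν₂ + ν₃) * ν₁ - ν₀ * E₁) * (γ₁ - α₁ * β₁)
      + (ν₀ + ν₁ + ν₂ + ν₃) * ((ν₀ + ν₁ + ν₂ + ν₃) * ν₂ - ν₀ * E₂) * (γ₂ - α₂ * β₂)
      + (ν₀ + ν₁ + ν₂ + ν₃) * ((ν₀ + ν₁ + ν₂ + ν₃) * ν₃ + ν₀ * (E₁ + E₂)) * (γ₃ - α₃ * β₃)
      + (ν₀ + ν₁ + ν₂ + ν₃) * ν₀ * (ν₁ + E₁) * (γ₁ - γ₀)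
      + (ν₀ + ν₁ + ν₂ + ν₃) * ν₀ * (ν₂ + E₂) * (γ₂ - γ₀)
      + (ν₀ + ν₁ + ν₂ + ν₃) * ν₀ * (ν₃ - E₁ - E₂) * (γ₃ - γ₀)
      + (((ν₀ + ν₁ + ν₂ + ν₃) + ν₀) * ((ν₀ + ν₁ + ν₂ + ν₃) * (ν₁ * (α₁ - α₀) * (β₁ - β₀) + ν₂ * (α₂ - α₀) * (β₂ - β₀) + ν₃ * (α₃ - α₀) * (β₃ - β₀))
      - (ν₁ * (α₁ - α₀) + ν₂ * (α₂ - α₀) + ν₃ * (α₃ - α₀)) * (ν₁ * (β₁ - β₀) + ν₂ * (β₂ - β₀) + ν₃ * (β₃ - β₀)))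
    - (ν₀ + ν₁ + ν₂ + ν₃) * ν₀ * ((ν₁ + E₁) * (α₁ - α₀) * (β₁ - β₀) + (ν₂ + E₂) * (α₂ - α₀) * (β₂ - β₀) + (ν₃ - E₁ - E₂) * (α₃ - α₀) * (β₃ - β₀)))
      + (ν₀ + ν₁ + ν₂ + ν₃) * ν₀ * α₀ * (E₁ * (β₃ - β₁) + E₂ * (β₃ - β₂))
      + (ν₀ + ν₁ + ν₂ + ν₃) * ν₀ * β₀ * (E₁ * (α₃ - α₁) + E₂ * (α₃ - α₂)) := by
    ring
  rw [e]
  have t1 : 0 ≤ (ν₀ + ν₁ + ν₂ + ν₃) * ((ν₀ + ν₁ + ν₂ + ν₃) * ν₁ - ν₀ * E₁) * (γ₁ - α₁ * β₁) :=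
    mul_nonneg (mul_nonneg hZ (by linarith)) (by linarith)
  have t2 : 0 ≤ (ν₀ + ν₁ + ν₂ + ν₃) * ((ν₀ + ν₁ + ν₂ + ν₃) * ν₂ - ν₀ * E₂) * (γ₂ - α₂ * β₂) :=
    mul_nonneg (mul_nonneg hZ (by linarith)) (by linarith)
  have t3 : 0 ≤ (ν₀ + ν₁ + ν₂ + ν₃) * ((ν₀ + ν₁ + ν₂ + ν₃) * ν₃ + ν₀ * (E₁ + E₂)) * (γ₃ - α₃ * β₃) :=
    mul_nonneg (mul_nonneg hZ (by positivity)) (by linarith)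
  have t4 : 0 ≤ (ν₀ + ν₁ + ν₂ + ν₃) * ν₀ * (ν₁ + E₁) * (γ₁ - γ₀) := mul_nonneg (by positivity) (by linarith)
  have t5 : 0 ≤ (ν₀ + ν₁ + ν₂ + ν₃) * ν₀ * (ν₂ + E₂) * (γ₂ - γ₀) := mul_nonneg (by positivity) (by linarith)
  have t6 : 0 ≤ (ν₀ + ν₁ + ν₂ + ν₃) * ν₀ * (ν₃ - E₁ - E₂) * (γ₃ - γ₀) :=
    mul_nonneg (mul_nonneg (mul_nonneg hZ h0) (by linarith)) (by linarith)
  have t7 : 0 ≤ (ν₀ + ν₁ + ν₂ + ν₃) * ν₀ * α₀ * (E₁ * (β₃ - β₁) + E₂ * (β₃ - β₂)) :=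
    mul_nonneg (by positivity) (add_nonneg (mul_nonneg hE1 (by linarith)) (mul_nonneg hE2 (by linarith)))
  have t8 : 0 ≤ (ν₀ + ν₁ + ν₂ + ν₃) * ν₀ * β₀ * (E₁ * (α₃ - α₁) + E₂ * (α₃ - α₂)) :=
    mul_nonneg (by positivity) (add_nonneg (mul_nonneg hE1 (by linarith)) (mul_nonneg hE2 (by linarith)))
  linarith

/-! ### The mass form (fibres of mass zero allowed) -/

/-- Comparison of densities of two live fibres from the cross inequality `a·ν' ≤ ν·a'`. [this work] -/
theorem div_le_div_of_cross {a ν a' ν' : ℝ} (hν : 0 < ν) (hν' : 0 < ν') (h : a * ν' ≤ ν * a') : a / ν ≤ a' / ν' := by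
  rw [div_le_div_iff₀ hν hν']; linarith [mul_comm ν a']

/-- Product of two densities of a live fibre against a third: `(a/ν)(b/ν) ≤ c/ν` from `ab ≤ νc`. [this work] -/
theorem div_mul_div_le {a b c ν : ℝ} (hν : 0 < ν) (h : a * b ≤ ν * c) : a / ν * (b / ν) ≤ c / ν := by
  rw [div_mul_div_comm, div_le_div_iff₀ (mul_pos hν hν) hν]; nlinarith

open Classical in
/-- Monotone densities with phantom values for an `α`-type family: from the masses and the Holley cross inequalities along
`0 ≤ 1, 2 ≤ 3` one gets densities `α_t` with `ν_t α_t = a_t`, `0 ≤ α₀ ≤ α₁, α₂ ≤ α₃`, equal to `a_t/ν_t` on live fibres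
`t = 1, 2, 3`. [this work] -/
theorem exists_dens {ν₀ ν₁ ν₂ ν₃ a₀ a₁ a₂ a₃ : ℝ} (h0 : 0 ≤ ν₀) (h1 : 0 ≤ ν₁) (h2 : 0 ≤ ν₂) (h3 : 0 ≤ ν₃)
    (ha0 : 0 ≤ a₀) (ha1 : 0 ≤ a₁) (ha2 : 0 ≤ a₂) (ha3 : 0 ≤ a₃) (ha0' : a₀ ≤ ν₀) (ha1' : a₁ ≤ ν₁) (ha2' : a₂ ≤ ν₂) (ha3' : a₃ ≤ ν₃)
    (m01 : a₀ * ν₁ ≤ ν₀ * a₁) (m02 : a₀ * ν₂ ≤ ν₀ * a₂) (m13 : a₁ * ν₃ ≤ ν₁ * a₃) (m23 : a₂ * ν₃ ≤ ν₂ * a₃)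
    (m03 : a₀ * ν₃ ≤ ν₀ * a₃) :
    ∃ α₀ α₁ α₂ α₃ : ℝ, ν₀ * α₀ = a₀ ∧ ν₁ * α₁ = a₁ ∧ ν₂ * α₂ = a₂ ∧ ν₃ * α₃ = a₃ ∧ 0 ≤ α₀ ∧ α₀ ≤ α₁ ∧ α₀ ≤ α₂ ∧ α₁ ≤ α₃ ∧
      α₂ ≤ α₃ ∧ (ν₁ ≠ 0 → α₁ = a₁ / ν₁) ∧ (ν₂ ≠ 0 → α₂ = a₂ / ν₂) ∧ (ν₃ ≠ 0 → α₃ = a₃ / ν₃) := by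
  have hα0 : 0 ≤ a₀ / ν₀ := div_nonneg ha0 h0
  -- comparison of the bottom density with a live fibre
  have cmp0 : ∀ {a ν : ℝ}, 0 < ν → 0 ≤ a → a₀ * ν ≤ ν₀ * a → a₀ / ν₀ ≤ a / ν := by
    intro a ν hν ha h
    rcases h0.eq_or_lt with hz | hz
    · rw [← hz, div_zero]; exact div_nonneg ha hν.le
    · exact div_le_div_of_cross hz hν h
  -- phantom densities: a fibre of mass zero copies a value that keeps the family monotone
  have mul_ite : ∀ {ν a f : ℝ}, 0 ≤ a → a ≤ ν → ν * (if ν = 0 then f else a / ν) = a := by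
    intro ν a f ha haν
    by_cases h : ν = 0
    · rw [if_pos h, h, zero_mul]; linarith
    · rw [if_neg h, mul_div_cancel₀ _ h]
  refine ⟨a₀ / ν₀, if ν₁ = 0 then a₀ / ν₀ else a₁ / ν₁, if ν₂ = 0 then a₀ / ν₀ else a₂ / ν₂,
    if ν₃ = 0 then max (if ν₁ = 0 then a₀ / ν₀ else a₁ / ν₁) (if ν₂ = 0 then a₀ / ν₀ else a₂ / ν₂) else a₃ / ν₃, ?_,
    mul_ite ha1 ha1', mul_ite ha2 ha2', mul_ite ha3 ha3', hα0, ?_, ?_, ?_, ?_, fun h => if_neg h, fun h => if_neg h, fun h => if_neg h⟩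
  · rcases h0.eq_or_lt with hz | hz
    · rw [← hz, zero_mul]; linarith
    · exact mul_div_cancel₀ _ (ne_of_gt hz)
  · by_cases hz : ν₁ = 0
    · rw [if_pos hz]
    · rw [if_neg hz]; exact cmp0 (lt_of_le_of_ne h1 (Ne.symm hz)) ha1 m01
  · by_cases hz : ν₂ = 0
    · rw [if_pos hz]
    · rw [if_neg hz]; exact cmp0 (lt_of_le_of_ne h2 (Ne.symm hz)) ha2 m02
  · by_cases hz3 : ν₃ = 0
    · rw [if_pos hz3]; exact le_max_left _ _
    · rw [if_neg hz3]
      have hν3 : 0 < ν₃ := lt_of_le_of_ne h3 (Ne.symm hz3)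
      by_cases hz : ν₁ = 0
      · rw [if_pos hz]; exact cmp0 hν3 ha3 m03
      · rw [if_neg hz]; exact div_le_div_of_cross (lt_of_le_of_ne h1 (Ne.symm hz)) hν3 m13
  · by_cases hz3 : ν₃ = 0
    · rw [if_pos hz3]; exact le_max_right _ _
    · rw [if_neg hz3]
      have hν3 : 0 < ν₃ := lt_of_le_of_ne h3 (Ne.symm hz3)
      by_cases hz : ν₂ = 0
      · rw [if_pos hz]; exact cmp0 hν3 ha3 m03
      · rw [if_neg hz]; exact div_le_div_of_cross (lt_of_le_of_ne h2 (Ne.symm hz)) hν3 m23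

open Classical in
/-- The `γ`-type density of a fibre `t ≠ 0`: `ν_t γ_t = c_t`, `γ_t ≥ γ₀ = c₀/ν₀` and `γ_t ≥ α_t β_t`, from the Holley inequality
`c₀ν_t ≤ ν₀c_t` and the fibre FKG inequality `a_t b_t ≤ ν_t c_t` (phantom value on a fibre of mass zero). [this work] -/
theorem exists_dens_meet {ν₀ ν c₀ c a b α β : ℝ} (h0 : 0 ≤ ν₀) (hν : 0 ≤ ν) (hc : 0 ≤ c) (hc' : c ≤ ν)
    (hα : ν ≠ 0 → α = a / ν) (hβ : ν ≠ 0 → β = b / ν) (m : c₀ * ν ≤ ν₀ * c) (f : a * b ≤ ν * c) :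
    ∃ γ : ℝ, ν * γ = c ∧ c₀ / ν₀ ≤ γ ∧ α * β ≤ γ := by
  by_cases hz : ν = 0
  · refine ⟨max (c₀ / ν₀) (α * β), ?_, le_max_left _ _, le_max_right _ _⟩
    rw [hz, zero_mul]; linarith
  · have hν' : 0 < ν := lt_of_le_of_ne hν (Ne.symm hz)
    refine ⟨c / ν, mul_div_cancel₀ _ hz, ?_, ?_⟩
    · rcases h0.eq_or_lt with h | h
      · rw [← h, div_zero]; exact div_nonneg hc hν'.le
      · exact div_le_div_of_cross h hν' m
    · rw [hα hz, hβ hz]; exact div_mul_div_le hν' f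

/-- **The real inequality behind FKG slot-locality at two join-primes (mass form).**  Fibre masses `ν_t ≥ 0` over the pattern
`2²` with `ν₁ν₂ ≤ ν₀ν₃`; masses `0 ≤ a_t, b_t ≤ ν_t`, `0 ≤ c_t ≤ ν_t` of `A`, `B`, `A ∩ B` in the fibres; the Holley cross
inequalities `a_sν_t ≤ ν_sa_t` along `0 ≤ 1, 2 ≤ 3` (and `0 ≤ 3`) for `a` and `b`, `c₀ν_t ≤ ν₀c_t`, and the fibre FKG inequalities
`a_tb_t ≤ ν_tc_t` (`t = 1, 2, 3`) imply `phiM ≥ 0`.  Every hypothesis is an instance of the four functions theorem on the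
lattice; see `…SahiE3TwoPrimeSlot`. [this work] -/
theorem phiM_nonneg {ν₀ ν₁ ν₂ ν₃ a₀ a₁ a₂ a₃ b₀ b₁ b₂ b₃ c₀ c₁ c₂ c₃ : ℝ}
    (h0 : 0 ≤ ν₀) (h1 : 0 ≤ ν₁) (h2 : 0 ≤ ν₂) (h3 : 0 ≤ ν₃) (hfkg : ν₁ * ν₂ ≤ ν₀ * ν₃)
    (ha0 : 0 ≤ a₀) (ha1 : 0 ≤ a₁) (ha2 : 0 ≤ a₂) (ha3 : 0 ≤ a₃) (ha0' : a₀ ≤ ν₀) (ha1' : a₁ ≤ ν₁) (ha2' : a₂ ≤ ν₂) (ha3' : a₃ ≤ ν₃)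
    (hb0 : 0 ≤ b₀) (hb1 : 0 ≤ b₁) (hb2 : 0 ≤ b₂) (hb3 : 0 ≤ b₃) (hb0' : b₀ ≤ ν₀) (hb1' : b₁ ≤ ν₁) (hb2' : b₂ ≤ ν₂) (hb3' : b₃ ≤ ν₃)
    (hc0 : 0 ≤ c₀) (hc1 : 0 ≤ c₁) (hc2 : 0 ≤ c₂) (hc3 : 0 ≤ c₃) (hc0' : c₀ ≤ ν₀) (hc1' : c₁ ≤ ν₁) (hc2' : c₂ ≤ ν₂) (hc3' : c₃ ≤ ν₃)
    (ma01 : a₀ * ν₁ ≤ ν₀ * a₁) (ma02 : a₀ * ν₂ ≤ ν₀ * a₂) (ma13 : a₁ * ν₃ ≤ ν₁ * a₃) (ma23 : a₂ * ν₃ ≤ ν₂ * a₃)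
    (ma03 : a₀ * ν₃ ≤ ν₀ * a₃)
    (mb01 : b₀ * ν₁ ≤ ν₀ * b₁) (mb02 : b₀ * ν₂ ≤ ν₀ * b₂) (mb13 : b₁ * ν₃ ≤ ν₁ * b₃) (mb23 : b₂ * ν₃ ≤ ν₂ * b₃)
    (mb03 : b₀ * ν₃ ≤ ν₀ * b₃)
    (mc1 : c₀ * ν₁ ≤ ν₀ * c₁) (mc2 : c₀ * ν₂ ≤ ν₀ * c₂) (mc3 : c₀ * ν₃ ≤ ν₀ * c₃)
    (f1 : a₁ * b₁ ≤ ν₁ * c₁) (f2 : a₂ * b₂ ≤ ν₂ * c₂) (f3 : a₃ * b₃ ≤ ν₃ * c₃) :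
    0 ≤ (2 * (ν₀ + ν₁ + ν₂ + ν₃) ^ 2 * (c₁ + c₂ + c₃)
    + (ν₁ + ν₂ + ν₃) * (a₀ + a₁ + a₂ + a₃) * (b₀ + b₁ + b₂ + b₃)
    - (ν₀ + ν₁ + ν₂ + ν₃) * ((ν₁ + ν₂ + ν₃) * (c₀ + c₁ + c₂ + c₃) + (a₀ + a₁ + a₂ + a₃) * (b₁ + b₂ + b₃)
        + (b₀ + b₁ + b₂ + b₃) * (a₁ + a₂ + a₃))) := by
  obtain ⟨α₀, α₁, α₂, α₃, eα0, eα1, eα2, eα3, hα0, hα01, hα02, hα13, hα23, lα1, lα2, lα3⟩ :=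
    exists_dens h0 h1 h2 h3 ha0 ha1 ha2 ha3 ha0' ha1' ha2' ha3' ma01 ma02 ma13 ma23 ma03
  obtain ⟨β₀, β₁, β₂, β₃, eβ0, eβ1, eβ2, eβ3, hβ0, hβ01, hβ02, hβ13, hβ23, lβ1, lβ2, lβ3⟩ :=
    exists_dens h0 h1 h2 h3 hb0 hb1 hb2 hb3 hb0' hb1' hb2' hb3' mb01 mb02 mb13 mb23 mb03
  obtain ⟨γ₁, eγ1, hγ1, hf1⟩ := exists_dens_meet h0 h1 hc1 hc1' lα1 lβ1 mc1 f1
  obtain ⟨γ₂, eγ2, hγ2, hf2⟩ := exists_dens_meet h0 h2 hc2 hc2' lα2 lβ2 mc2 f2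
  obtain ⟨γ₃, eγ3, hγ3, hf3⟩ := exists_dens_meet h0 h3 hc3 hc3' lα3 lβ3 mc3 f3
  have eγ0 : ν₀ * (c₀ / ν₀) = c₀ := by
    rcases h0.eq_or_lt with hz | hz
    · rw [← hz, zero_mul]; linarith
    · exact mul_div_cancel₀ _ (ne_of_gt hz)
  have key := phiD_nonneg h0 h1 h2 h3 hfkg hα0 hα01 hα02 hα13 hα23 hβ0 hβ01 hβ02 hβ13 hβ23 hγ1 hγ2 hγ3 hf1 hf2 hf3
  rw [eα0, eα1, eα2, eα3, eβ0, eβ1, eβ2, eβ3, eγ0, eγ1, eγ2, eγ3] at key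
  exact key

end Summit.CriticalPhenomena.PercolationContinuityZ3.Theorems.SahiE3TwoPrimeSlot
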